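import Mathlib
import Summits.KontsevichZagierPeriods.Zeta5Search.TwoTaleOmega.OmegaKit

/-!
# (bmiss)@Ω — PILOT INSTANCE b/L: the data identity of the direction-`b` telescoper, first tale

HONEST FRAMING: systematic search; no irrationality claim unless certified. Pure finite algebra over `ℚ`; no named
fact, no `sorry`.

Blueprint F10, instance (direction `δ_b = (0,1,0,0,0)`, side L = first tale), RECURRENCE.md §13.10–13.12. The WZ-style
certificate of `certs/tele/bmiss_general/certificates.json` ("b"): polynomials `c_k(p)` (`cB0 … cB3`) and
`Cert_L(p;t) = t (t+a−e)(t+a−f)(t+g−1)` with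
  `Σ_{k<4} c_k(p) · F_L(p + kδ_b; t) = G(t+1) − G(t)`, `G = Cert_L · F_L(p;·)`, `F_L(p;t) = vL(p)(t) = num/den`.
Here this is proved as an identity of partial-fraction DATA (`dataStep_bL`):
  `comb4 (cB p) (k ↦ vL (p + kδ_b)) = S(GbL p) − GbL p`,
by Lemma U (`PF.eq_of_eval_eq`) from the function identity off the finite set `SB p`, which in turn is the polynomial
identity `cB_sum` (one `ring`) transported through the block shift law. Feeding `dataStep_bL` to
`FormalBarnesStep.lam1_recurrence[_zero]` / `lam0_recurrence[_zero]` gives the four-term recurrence of the first-tale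
halves of `U₁`, `U₀` along `δ_b` (the legitimacy input `h5` is instance work for the node bookkeeping, F11).
-/

noncomputable section

open Finset Polynomial
open Literature.NumberTheory.Irrationality.Zudilin2014
open Summit.KontsevichZagierPeriods.Zeta5Search.FormalBarnes

namespace Summit.KontsevichZagierPeriods.Zeta5Search.TwoTaleOmega

/-! ### The certificate polynomials of direction `b` -/

/-- `c₀(p)` of the direction-`b` telescoper. -/
def cB0 (a b e f g : ℚ) : ℚ :=
  -b * e * f + b * e * f * g - b ^ 2 * f + b ^ 2 * f * g - b ^ 2 * e + b ^ 2 * e * g - b ^ 2 * e * f - b ^ 3 + b ^ 3 * g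
  - b ^ 3 * f - b ^ 3 * e - b ^ 4 + a * b * f - a * b * f * g + a * b * e - a * b * e * g + 2 * a * b ^ 2 - 2 * a * b ^ 2 * g
  + a * b ^ 2 * f + a * b ^ 2 * e + 2 * a * b ^ 3 - a ^ 2 * b + a ^ 2 * b * g - a ^ 2 * b ^ 2

/-- `c₁(p)` of the direction-`b` telescoper. -/
def cB1 (a b e f g : ℚ) : ℚ :=
  1 - g + 3 * f - f * g + 3 * e - e * g + e * f - e * f * g + 4 * b - 3 * b * g + 7 * b * f - 2 * b * f * g + 7 * b * e
  - 2 * b * e * g + b * e * f + 6 * b ^ 2 - 3 * b ^ 2 * g + 4 * b ^ 2 * f + 4 * b ^ 2 * e + 3 * b ^ 3 - 3 * a + 2 * a * g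
  - 3 * a * f + a * f * g - 3 * a * e + a * e * g + a * e * f - 8 * a * b + 4 * a * b * g - 3 * a * b * f - 3 * a * b * e
  - 5 * a * b ^ 2 + 2 * a ^ 2 - a ^ 2 * g + 2 * a ^ 2 * b

/-- `c₂(p)` of the direction-`b` telescoper. -/
def cB2 (a b e f g : ℚ) : ℚ :=
  -3 + 3 * g - 7 * f + f * g - 7 * e + e * g - 6 * b + 3 * b * g - 5 * b * f - 5 * b * e - 3 * b ^ 2 + 5 * a - 2 * a * g
  + 2 * a * f + 2 * a * e + 4 * a * b - a ^ 2

/-- `c₃(p)` of the direction-`b` telescoper (nonzero on the rule domain: the recurrence can be solved for the top term). -/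
def cB3 (a b e f g : ℚ) : ℚ := 1 - g + 2 * f + 2 * e + b - a

/-- **The polynomial identity behind the certificate** (first tale):
`c₀ + c₁ (t+b) + c₂ (t+b)(t+b+1) + c₃ (t+b)(t+b+1)(t+b+2) = (t+e)(t+f)(t+b)(t+a) − t(t+a−e)(t+a−f)(t+g−1)`. -/
theorem cB_identity (a b e f g t : ℚ) :
    cB0 a b e f g + cB1 a b e f g * (t + b) + cB2 a b e f g * ((t + b) * (t + b + 1))
      + cB3 a b e f g * ((t + b) * (t + b + 1) * (t + b + 2))
    = (t + e) * (t + f) * (t + b) * (t + a) - t * (t + (a - e)) * (t + (a - f)) * (t + (g - 1)) := by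
  unfold cB0 cB1 cB2 cB3; ring

namespace Pt

variable (p : Pt)

/-- The certificate coefficients at the integer point `p`. -/
def cB : Fin 4 → ℚ := ![cB0 p.a p.b p.e p.f p.g, cB1 p.a p.b p.e p.f p.g, cB2 p.a p.b p.e p.f p.g, cB3 p.a p.b p.e p.f p.g]

/-- `cB 0 = c₀`. -/
theorem cB_zero : p.cB 0 = cB0 p.a p.b p.e p.f p.g := rfl

/-- `cB 1 = c₁`. -/
theorem cB_one : p.cB 1 = cB1 p.a p.b p.e p.f p.g := rfl

/-- `cB 2 = c₂`. -/
theorem cB_two : p.cB 2 = cB2 p.a p.b p.e p.f p.g := rfl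

/-- `cB 3 = c₃`. -/
theorem cB_three : p.cB 3 = cB3 p.a p.b p.e p.f p.g := rfl

/-- The identity `cB_identity` in the indexed form used by the recurrence. -/
theorem cB_sum (t : ℚ) : ∑ k : Fin 4, p.cB k * ∏ i ∈ range (k : ℕ), (t + ((p.b + i : ℤ) : ℚ))
    = (t + p.e) * (t + p.f) * (t + p.b) * (t + p.a)
      - t * (t + ((p.a : ℚ) - p.e)) * (t + ((p.a : ℚ) - p.f)) * (t + ((p.g : ℚ) - 1)) := by
  rw [← cB_identity, Fin.sum_univ_four, cB_zero, cB_one, cB_two, cB_three]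
  simp only [Fin.val_zero, Fin.val_one, Fin.val_two, show ((3 : Fin 4) : ℕ) = 3 from rfl, prod_range_zero,
    prod_range_succ]
  push_cast
  ring

/-! ### The telescoped datum `G = Cert_L · vL` -/

/-- `GbL p` = data of `t (t+a−e)(t+a−f)(t+g−1) · vL(p)(t)`. -/
def GbL : PF := (((p.vL.mulLin 0).mulLin (p.a - p.e)).mulLin (p.a - p.f)).mulLin (p.g - 1)

/-- `GbL` creates no poles. -/
theorem poles_GbL : p.GbL.poles ⊆ p.vL.poles :=
  (PF.poles_mulLin_subset _ _).trans ((PF.poles_mulLin_subset _ _).trans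
    ((PF.poles_mulLin_subset _ _).trans (PF.poles_mulLin_subset _ _)))

/-- Value of `GbL` off the poles of `vL`. -/
theorem eval_GbL (t : ℚ) (ht : ∀ k ∈ p.vL.poles, t + k ≠ 0) : p.GbL.eval t
    = (t + ((p.g - 1 : ℤ) : ℚ)) * ((t + ((p.a - p.f : ℤ) : ℚ)) * ((t + ((p.a - p.e : ℤ) : ℚ))
        * ((t + ((0 : ℤ) : ℚ)) * p.vL.eval t))) := by
  unfold GbL
  rw [PF.eval_mulLin _ _ t (fun k hk => ht k ((PF.poles_mulLin_subset _ _).trans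
        ((PF.poles_mulLin_subset _ _).trans (PF.poles_mulLin_subset _ _)) hk)),
    PF.eval_mulLin _ _ t (fun k hk => ht k ((PF.poles_mulLin_subset _ _).trans (PF.poles_mulLin_subset _ _) hk)),
    PF.eval_mulLin _ _ t (fun k hk => ht k ((PF.poles_mulLin_subset _ _) hk)),
    PF.eval_mulLin _ _ t ht]

/-! ### Bookkeeping: the exceptional set, pole locations, numerators along `δ_b` -/

/-- `a₄ ≤ a₄*`. -/
theorem three_le_amax (a : Fin 4 → ℤ) : a 3 ≤ amax a := le_trans (le_max_right _ _) (le_max_right _ _)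

/-- The poles of `vL q` sit in `[a, g]`. -/
theorem poles_vL_Icc (q : Pt) : q.vL.poles ⊆ Icc q.a q.g := fun j hj => by
  have h := mem_Ico.1 (q.poles_vL hj)
  exact mem_Icc.2 ⟨le_trans (three_le_amax q.t1a) h.1, h.2.le⟩

/-- The finite exceptional set off which the function identity is used. -/
def SB : Finset ℤ := Icc (min (min 1 (p.a - p.e + 1)) (min (p.a - p.f + 1) p.a)) (p.g + 1)

/-- Membership in `SB` from two inequalities. -/
theorem mem_SB {j : ℤ} (h1 : min (min 1 (p.a - p.e + 1)) (min (p.a - p.f + 1) p.a) ≤ j) (h2 : j ≤ p.g + 1) :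
    j ∈ p.SB := mem_Icc.2 ⟨h1, h2⟩

/-- The first-tale numerator of the hinge, spelled out. -/
theorem num_eq (q : Pt) : num q.t1a q.t1b = block 1 q.e * block (q.a - q.e + 1) q.f * block (q.a - q.f + 1) q.b := rfl

/-- The first-tale denominator of the hinge, spelled out. -/
theorem den_eq (q : Pt) : den q.t1a q.t1b = block q.a q.g := rfl

/-- Along `δ_b` the numerator acquires the block `(t+b)⋯(t+b+k−1)`. -/
theorem num_addB (k : ℕ) (h : p.a - p.f + 1 ≤ p.b) :
    num (p.addB k).t1a (p.addB k).t1b = num p.t1a p.t1b * block p.b (p.b + k) := by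
  rw [num_eq, num_eq]
  simp only [addB]
  rw [← block_mul_block h (show p.b ≤ p.b + k by omega)]
  ring

/-- Along `δ_b` the denominator does not move. -/
theorem den_addB (k : ℤ) : den (p.addB k).t1a (p.addB k).t1b = den p.t1a p.t1b := rfl

/-- The inequalities of the rule domain that the proof uses, read off `Admissible`. -/
theorem ineqs (h : Admissible p.t1a p.t1b) :
    1 ≤ p.e ∧ 1 ≤ p.f ∧ 1 ≤ p.a ∧ p.a - p.e + 1 ≤ p.f ∧ p.a - p.f + 1 ≤ p.b ∧ p.a < p.g := by
  refine ⟨?_, ?_, ?_, ?_, ?_, ?_⟩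
  · simpa [Pt.t1a, Pt.t1b] using h.lower 0 (by decide) 0
  · simpa [Pt.t1a, Pt.t1b] using h.lower 0 (by decide) 1
  · simpa [Pt.t1a, Pt.t1b] using h.lower 0 (by decide) 3
  · simpa [Pt.t1a, Pt.t1b] using h.lower 1 (by decide) 1
  · simpa [Pt.t1a, Pt.t1b] using h.lower 2 (by decide) 2
  · simpa [Pt.t1a, Pt.t1b] using h.upper 3

/-- Off the integer translates in a set containing `[a, g)`, `den` does not vanish. -/
theorem den_eval_ne_zero (q : Pt) {s : ℚ} (hs : ∀ j ∈ Ico q.a q.g, s + j ≠ 0) : (den q.t1a q.t1b).eval s ≠ 0 := by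
  rw [den_eq]
  exact eval_block_ne_zero fun i hi heq => hs i hi (by rw [heq, neg_add_cancel])

end Pt

/-- Equality of data from equality of the three parts. -/
theorem PF.eq_of_parts {v w : PF} (h : v.poly = w.poly ∧ v.simple = w.simple ∧ v.double = w.double) : v = w := by
  cases v; cases w
  obtain ⟨h1, h2, h3⟩ := h
  simp only at h1 h2 h3
  subst h1; subst h2; subst h3; rfl

namespace Pt

variable (p : Pt)

/-! ### The data identity -/

/-- **Pilot instance b/L.** For `p` with `p, p+δ_b, p+2δ_b, p+3δ_b` admissible (first tale), the direction-`b`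
certificate holds as an identity of partial-fraction data:
`Σ_k c_k(p) · vL(p + kδ_b) = S(GbL p) − GbL p`. -/
theorem dataStep_bL (hadm : ∀ k : Fin 4, Admissible (p.addB ((k : ℕ) : ℤ)).t1a (p.addB ((k : ℕ) : ℤ)).t1b) :
    PF.comb4 p.cB (fun k : Fin 4 => (p.addB ((k : ℕ) : ℤ)).vL) = p.GbL.shift.add (p.GbL.smul (-1)) := by
  have hadm0 : Admissible p.t1a p.t1b := by simpa [addB_zero] using hadm 0
  obtain ⟨e1, f1, a1, ef, fb, ag⟩ := p.ineqs hadm0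
  -- pole locations inside `SB`
  have hvk : ∀ k : Fin 4, (p.addB ((k : ℕ) : ℤ)).vL.poles ⊆ p.SB := fun k j hj => by
    have h := mem_Icc.1 (poles_vL_Icc _ hj)
    simp only [addB] at h
    exact p.mem_SB (by omega) (by omega)
  have hv0 : p.vL.poles ⊆ p.SB := fun j hj => by
    have h := mem_Icc.1 (poles_vL_Icc _ hj)
    exact p.mem_SB (by omega) (by omega)
  have hG : (p.GbL.shift.add (p.GbL.smul (-1))).poles ⊆ p.SB := fun j hj => by
    rcases mem_union.1 (PF.poles_shift_sub_subset _ hj) with h | h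
    · obtain ⟨i, hi, rfl⟩ := mem_image.1 h
      have h' := mem_Icc.1 (poles_vL_Icc _ (p.poles_GbL hi))
      exact p.mem_SB (by omega) (by omega)
    · exact hv0 (p.poles_GbL h)
  have hC : (PF.comb4 p.cB (fun k : Fin 4 => (p.addB ((k : ℕ) : ℤ)).vL)).poles ⊆ p.SB :=
    (PF.poles_comb4_subset _ _).trans (union_subset (union_subset (hvk 0) (hvk 1)) (union_subset (hvk 2) (hvk 3)))
  refine PF.eq_of_parts (PF.eq_of_eval_eq _ _ p.SB ((PF.simple_support_subset_poles _).trans hC)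
    ((PF.double_support_subset_poles _).trans hC) ((PF.simple_support_subset_poles _).trans hG)
    ((PF.double_support_subset_poles _).trans hG) fun t ht => ?_)
  -- the function identity off `SB`
  have nz : ∀ j : ℤ, min (min 1 (p.a - p.e + 1)) (min (p.a - p.f + 1) p.a) ≤ j → j ≤ p.g + 1 → t + (j : ℚ) ≠ 0 :=
    fun j h1 h2 => ht j (p.mem_SB h1 h2)
  have nz1 : ∀ j : ℤ, min (min 1 (p.a - p.e + 1)) (min (p.a - p.f + 1) p.a) ≤ j + 1 → j + 1 ≤ p.g + 1 →
      t + 1 + (j : ℚ) ≠ 0 := fun j h1 h2 => by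
    have h := nz (j + 1) h1 h2
    push_cast at h
    rwa [show t + 1 + (j : ℚ) = t + ((j : ℚ) + 1) by ring]
  rw [PF.eval_comb4, PF.eval_shift_sub,
    p.eval_GbL (t + 1) (fun k hk => by
      have h := mem_Icc.1 (poles_vL_Icc _ hk)
      exact nz1 k (by omega) (by omega)),
    p.eval_GbL t (fun k hk => by
      have h := mem_Icc.1 (poles_vL_Icc _ hk)
      exact nz k (by omega) (by omega))]
  -- values of the hinge data
  have hvalk : ∀ k : Fin 4, (p.addB ((k : ℕ) : ℤ)).vL.eval t = (num p.t1a p.t1b).eval t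
      * (∏ i ∈ range (k : ℕ), (t + ((p.b + i : ℤ) : ℚ))) / (den p.t1a p.t1b).eval t := fun k => by
    rw [Pt.vL_eval _ (hadm k) (fun j hj => by
        have h := mem_Ico.1 hj
        rw [Pt.t1a_three, Pt.t1b_three] at h
        simp only [addB] at h
        exact nz j (by omega) (by omega)),
      p.num_addB k fb, den_addB, Polynomial.eval_mul, ← PF.prod_range_eq_eval_block]
  have hval0 : p.vL.eval t = (num p.t1a p.t1b).eval t / (den p.t1a p.t1b).eval t :=
    Pt.vL_eval _ hadm0 (fun j hj => by
      have h := mem_Ico.1 hj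
      rw [Pt.t1a_three, Pt.t1b_three] at h
      exact nz j (by omega) (by omega))
  have hval1 : p.vL.eval (t + 1) = (num p.t1a p.t1b).eval (t + 1) / (den p.t1a p.t1b).eval (t + 1) :=
    Pt.vL_eval _ hadm0 (fun j hj => by
      have h := mem_Ico.1 hj
      rw [Pt.t1a_three, Pt.t1b_three] at h
      exact nz1 j (by omega) (by omega))
  simp_rw [hvalk]
  rw [hval0, hval1]
  -- block shifts of numerator and denominator
  have u1 : t + 1 ≠ 0 := by have h := nz 1 (by omega) (by omega); push_cast at h; exact h
  have u2 : t + ((p.a : ℚ) - p.e + 1) ≠ 0 := by have h := nz (p.a - p.e + 1) (by omega) (by omega); push_cast at h; exact h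
  have u3 : t + ((p.a : ℚ) - p.f + 1) ≠ 0 := by have h := nz (p.a - p.f + 1) (by omega) (by omega); push_cast at h; exact h
  have ua : t + (p.a : ℚ) ≠ 0 := nz p.a (by omega) (by omega)
  have ug : t + (p.g : ℚ) ≠ 0 := nz p.g (by omega) (by omega)
  have hD0 : (den p.t1a p.t1b).eval t ≠ 0 := p.den_eval_ne_zero fun j hj => by
    have h := mem_Ico.1 hj; exact nz j (by omega) (by omega)
  have hD1 : (den p.t1a p.t1b).eval (t + 1) ≠ 0 := p.den_eval_ne_zero fun j hj => by
    have h := mem_Ico.1 hj; exact nz1 j (by omega) (by omega)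
  have hN : (num p.t1a p.t1b).eval (t + 1)
      = (num p.t1a p.t1b).eval t * ((t + p.e) * (t + p.f) * (t + p.b))
        / ((t + 1) * (t + ((p.a : ℚ) - p.e + 1)) * (t + ((p.a : ℚ) - p.f + 1))) := by
    rw [eq_div_iff (mul_ne_zero (mul_ne_zero u1 u2) u3)]
    have h1 := eval_block_succ_mul (show (1 : ℤ) ≤ p.e from e1) t
    have h2 := eval_block_succ_mul ef t
    have h3 := eval_block_succ_mul fb t
    push_cast at h1 h2 h3
    rw [num_eq, Polynomial.eval_mul, Polynomial.eval_mul, Polynomial.eval_mul, Polynomial.eval_mul]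
    calc _ = ((block 1 p.e).eval (t + 1) * (t + 1))
          * ((block (p.a - p.e + 1) p.f).eval (t + 1) * (t + ((p.a : ℚ) - p.e + 1)))
          * ((block (p.a - p.f + 1) p.b).eval (t + 1) * (t + ((p.a : ℚ) - p.f + 1))) := by ring
      _ = _ := by rw [h1, h2, h3]; ring
  have hD : (den p.t1a p.t1b).eval (t + 1) = (den p.t1a p.t1b).eval t * (t + p.g) / (t + p.a) := by
    rw [eq_div_iff ua, den_eq]
    exact eval_block_succ_mul ag.le t
  rw [hN, hD, show (∑ k : Fin 4, p.cB k * ((num p.t1a p.t1b).eval t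
        * (∏ i ∈ range (k : ℕ), (t + ((p.b + i : ℤ) : ℚ))) / (den p.t1a p.t1b).eval t))
      = (num p.t1a p.t1b).eval t / (den p.t1a p.t1b).eval t
        * ∑ k : Fin 4, p.cB k * ∏ i ∈ range (k : ℕ), (t + ((p.b + i : ℤ) : ℚ)) by
      rw [Finset.mul_sum]; exact Finset.sum_congr rfl fun k _ => by ring,
    cB_sum]
  push_cast
  field_simp
  ring

end Pt

end Summit.KontsevichZagierPeriods.Zeta5Search.TwoTaleOmega
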